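import Summits.BirchSwinnertonDyer.BirchSwinnertonDyer.Theorems.AlignedTransportAtTwoMainConjectureOfRankZeroBSDAtTwoFineRoadCycTorsion
import HarnessLib

/-!
# Inflation–restriction, SHARP form on the seed cell: with `E(ℚ(ζ_{2^∞}))[2^∞] = 0` the restriction
# `H¹(ℚ_∞, E[2^∞]) → H¹(ℚ(ζ_{2^∞}), E[2^∞])` is INJECTIVE — the descent maps `fd`, `fd^{rel}`, `fyʳ` of
# road (b″) are ONTO (zero cokernel), not merely of finite cokernel

Cell `bsd-f1-sign2`, WIDTH-5 attach seat `bsd-line-att-p4` (gen 3) on line `birth` of crux C2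
stmt-BirchSwinnertonDyer-22298 `MainConjectureOfRankZeroBSDAtTwo`; a `--supports 22298 --as helper` file, sequel of
`…FineRoadCycTorsion` (`E(ℚ(ζ_{2^∞}))[2^∞] = 0` without rational `2`-torsion) and `…FineRoadInfRes` §1 (att-p4 g2:
the FINITE form). HONEST FRAMING: THEOREMS ONLY — no definition, no named fact, no `sorry`; BSD is NOT proved by any
of this.

* §1 **`resOfLe_injective_of_fixedPoints_eq_bot`** (any topological group `G`, subgroups `H₁ ≤ H₂` with `H₁` normalised
  by `H₂`, discrete `G`-module `M` with continuous orbit maps and `M^{H₁} = 0`): `res : H¹(H₂, M) → H¹(H₁, M)` is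
  INJECTIVE. Proof = Steps 1–2 of `InfRes.finite_ker_resOfLe` (a kernel class has a representative vanishing on `H₁`,
  hence constant on `H₁`-cosets with values in `M^{H₁} = 0`); no index hypothesis.
* §2 (`K = ℚ`, `p = 2`, cyclotomic `κ`, no rational `2`-torsion) **`resOfLe_kerCyclotomicCharacter_injective_two`**: the
  restriction `H¹(ℚ_∞, E[2^∞]) → H¹(ℚ(ζ_{2^∞}), E[2^∞])` along `ker χ₂ ≤ ker κ` is injective; hence so are its
  restrictions to `Sel`, `Sel^{rel ∞}`, `Sel₀`, `Sel₀^{rel ∞}` — the Pontryagin-dual descent maps `fd : X(E/ℚ(ζ_{2^∞}))_Δ →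
  X(E/ℚ_∞)`, `fd^{rel}`, `fyʳ` of skeletons v4–v6 are SURJECTIVE on every curve of the seed cell (the global
  `H¹(Δ, ·)`/`H²(Δ, ·)` obstructions of ARCH-NETTING (ii) vanish identically; what remains of (ii) is local at the prime
  above `2`).

References: J.-P. Serre, *Galois Cohomology* I §2.6 (inflation–restriction); R. Greenberg, LNM 1716 (1999) §3
Lemma 3.1; K. Ribet, Enseign. Math. 27 (1981) Thm. 1.
-/

set_option autoImplicit false
-- the Theorems namespace of this sub repeats the summit name by design (D-0017 nested layout)
set_option linter.dupNamespace false

noncomputable section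

open scoped Classical

namespace Summit.BirchSwinnertonDyer.BirchSwinnertonDyer.Theorems.AlignedTransportAtTwoFineRoad.InfResSharp

open Literature.NumberTheory.EllipticCurves Literature.NumberTheory.GaloisRepresentations

universe u

/-! ## §1 `M^{H₁} = 0` ⟹ `res : H¹(H₂, M) → H¹(H₁, M)` is injective -/

section Generic

variable {G : Type u} [Group G] [TopologicalSpace G] [IsTopologicalGroup G]
  {M : Type u} [AddCommGroup M] [DistribMulAction G M] [TopologicalSpace M] [DiscreteTopology M]

/-- **Inflation–restriction, injective form.** Let `H₁ ≤ H₂` be subgroups of a topological group `G` with `H₁`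
normalised by `H₂`, and `M` a discrete `G`-module with continuous orbit maps and NO non-zero `H₁`-fixed point. Then
the restriction `H¹(H₂, M) → H¹(H₁, M)` is injective: a kernel class is represented by a crossed homomorphism `ψ`
vanishing on `H₁` (subtract the principal part), and then `h • ψ(g) = ψ(hg) = ψ(g · g⁻¹hg) = ψ(g)` for `h ∈ H₁`, so
`ψ` takes values in `M^{H₁} = 0`. [cite: SerreGaloisCohomology1997, I §2.6 (inflation–restriction) and I §5.1] -/
theorem resOfLe_injective_of_fixedPoints_eq_bot {H₁ H₂ : Subgroup G} (hle : H₁ ≤ H₂)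
    (hnorm : ∀ g ∈ H₂, ∀ h ∈ H₁, g⁻¹ * h * g ∈ H₁) (hcont : ∀ m : M, Continuous fun g : G ↦ g • m)
    (hfix : FixedPoints.addSubgroup H₁ M = ⊥) :
    Function.Injective (resOfLe M hle) := by
  refine (injective_iff_map_eq_zero _).2 fun c hc ↦ ?_
  obtain ⟨z, rfl⟩ := oneCocycleClass_surjective (discreteTopRep H₂ M) c
  obtain ⟨a, ha⟩ := (CocycleCriteria.resOfLe_oneCocycleClass_eq_zero_iff hle z).mp hc
  -- the principal crossed homomorphism of `a` on `H₂`
  let π : contOneCocycles (discreteTopRep H₂ M) :=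
    ⟨⟨fun g : H₂ ↦ (g : G) • a - a, ((hcont a).comp continuous_subtype_val).sub continuous_const⟩,
      fun g h ↦ by
        change ((g * h : H₂) : G) • a - a =
          ((g : G) • a - a) + (discreteTopRep H₂ M).ρ g (((h : G) • a - a))
        rw [discreteTopRep_ρ_apply, Subgroup.smul_def, Subgroup.coe_mul, mul_smul, smul_sub]
        abel⟩
  have hπ0 : oneCocycleClass _ π = 0 :=
    (oneCocycleClass_eq_zero_iff _ π).mpr ⟨a, fun g ↦ by rw [discreteTopRep_ρ_apply, Subgroup.smul_def]; rfl⟩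
  -- `ψ = z - π` vanishes on `H₁`
  set ψ := z - π with hψdef
  have hψc : oneCocycleClass _ ψ = oneCocycleClass _ z := by rw [hψdef, oneCocycleClass_sub, hπ0, sub_zero]
  have hψ0 : ∀ x : H₁, ψ.1 (Subgroup.inclusion hle x) = 0 := fun x ↦ by
    change z.1 (Subgroup.inclusion hle x) - (((Subgroup.inclusion hle x : H₂) : G) • a - a) = 0
    rw [ha x, Subgroup.coe_inclusion, sub_self]
  -- its values are `H₁`-fixed, hence zero
  have hinv : ∀ (g : H₂) (h : H₁), h • ψ.1 g = ψ.1 g := by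
    intro g h
    set h' : H₂ := Subgroup.inclusion hle h with hh'
    have h1 : ψ.1 (h' * g) = (discreteTopRep H₂ M).ρ h' (ψ.1 g) := by
      rw [ψ.2 h' g, hψ0 h, zero_add]
    have hk : ((g⁻¹ * h' * g : H₂) : G) ∈ H₁ := hnorm g g.2 h h.2
    have h0 : ψ.1 (g⁻¹ * h' * g) = 0 := by
      have e : Subgroup.inclusion hle ⟨((g⁻¹ * h' * g : H₂) : G), hk⟩ = g⁻¹ * h' * g := Subtype.ext rfl
      rw [← e]
      exact hψ0 ⟨_, hk⟩
    have h2 : h' * g = g * (g⁻¹ * h' * g) := by group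
    rw [h2, ψ.2 g _, h0, map_zero, add_zero, discreteTopRep_ρ_apply, Subgroup.smul_def] at h1
    rw [Subgroup.smul_def]
    exact h1.symm
  have hψzero : ψ = 0 := by
    apply Subtype.ext
    ext g
    have hmem : ψ.1 g ∈ FixedPoints.addSubgroup H₁ M := (FixedPoints.mem_addSubgroup H₁ M _).mpr fun h ↦ hinv g h
    rw [hfix, AddSubgroup.mem_bot] at hmem
    exact hmem
  rw [← hψc, hψzero, oneCocycleClass_zero]

end Generic

/-! ## §2 The seed cell: the descent restrictions are injective -/

section SeedCell

open WeierstrassCurve Literature.NumberTheory.EllipticCurves.Greenberg1999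

variable (W : WeierstrassCurve ℚ) [W.IsElliptic] (κ : ZpExtension ℚ 2)

/-- **`res : H¹(ℚ_∞, E[2^∞]) ↪ H¹(ℚ(ζ_{2^∞}), E[2^∞])` is INJECTIVE on the seed cell.** For an elliptic `E/ℚ` without
a rational point of order `2` and the cyclotomic `ℤ₂`-extension: `E(ℚ(ζ_{2^∞}))[2^∞] = 0`
(`CycTorsion.fixedPoints_kerCyclotomicCharacter_geomPrimaryTorsion_eq_bot`), so §1 applies along `ker χ₂ ≤ ker κ`. Dually the
descent map `fd : X(E/ℚ(ζ_{2^∞}))_Δ → X(E/ℚ_∞)` and its relaxed / fine variants are ONTO.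
[cite: SerreGaloisCohomology1997, I §2.6 (inflation–restriction)] [cite: GreenbergLNM1716, §3 Lemma 3.1] -/
theorem resOfLe_kerCyclotomicCharacter_injective_two (ht : ∀ x : ℚ, ¬ HasRationalTwoTorsionX W x)
    (hκ : κ.IsCyclotomic) :
    Function.Injective (W.resOfLe 2 (InfRes.ker_cyclotomicCharacter_le_kerSubgroup κ hκ)) :=
  resOfLe_injective_of_fixedPoints_eq_bot (M := W.geomPrimaryTorsion 2)
    (InfRes.ker_cyclotomicCharacter_le_kerSubgroup κ hκ)
    (fun g _ h hh ↦ (MonoidHom.normal_ker _).conj_mem' h hh g)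
    (fun m ↦ W.continuous_smul_geomPrimaryTorsion 2 m)
    (CycTorsion.fixedPoints_kerCyclotomicCharacter_geomPrimaryTorsion_eq_bot W ht)

/-- **Two classes of `H¹(ℚ_∞, E[2^∞])` with the same image over `ℚ(ζ_{2^∞})` are equal** (seed cell) — in
particular two Selmer / relaxed-Selmer / fine classes; the kernels of the Selmer-level restrictions of
`…FineRoadInfRes`/`…FineRoadInfResRel` are TRIVIAL, not just finite. [cite: GreenbergLNM1716, §3 Lemma 3.1] -/
theorem eq_of_resOfLe_kerCyclotomicCharacter_eq_two (ht : ∀ x : ℚ, ¬ HasRationalTwoTorsionX W x)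
    (hκ : κ.IsCyclotomic) {c c' : W.subgroupH1 2 κ.kerSubgroup}
    (h : W.resOfLe 2 (InfRes.ker_cyclotomicCharacter_le_kerSubgroup κ hκ) c =
      W.resOfLe 2 (InfRes.ker_cyclotomicCharacter_le_kerSubgroup κ hκ) c') : c = c' :=
  resOfLe_kerCyclotomicCharacter_injective_two W κ ht hκ h

/-- **`E(ℚ_∞)[2^∞] = 0` on the seed cell**: for an elliptic `E/ℚ` without a rational point of order `2` and the
cyclotomic `ℤ₂`-extension `ℚ_∞ = ℚ̄^{ker κ}`, no non-zero `2`-power torsion point is fixed by `ker κ`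
(`ker χ₂ ≤ ker κ` and `E(ℚ(ζ_{2^∞}))[2^∞] = 0`). The strong form of Greenberg's «`E(ℚ_∞)[p^∞]` finite» (tree
`finite_fixedPoints_kerSubgroup_geomPrimaryTorsion_rat`) and the hypothesis «`E(F)[p] = 0`» of the control / no-finite-
submodule / Cassels-surjectivity facts, at `p = 2` on the seed cell. [cite: GreenbergLNM1716, §1 p. 62 and §4 Prop. 4.13] -/
theorem fixedPoints_kerSubgroup_geomPrimaryTorsion_eq_bot_two (ht : ∀ x : ℚ, ¬ HasRationalTwoTorsionX W x)
    (hκ : κ.IsCyclotomic) : FixedPoints.addSubgroup κ.kerSubgroup (W.geomPrimaryTorsion 2) = ⊥ := by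
  rw [eq_bot_iff]
  intro m hm
  rw [← CycTorsion.fixedPoints_kerCyclotomicCharacter_geomPrimaryTorsion_eq_bot W ht]
  rw [FixedPoints.mem_addSubgroup] at hm ⊢
  rintro ⟨h, hh⟩
  exact hm ⟨h, InfRes.ker_cyclotomicCharacter_le_kerSubgroup κ hκ hh⟩

end SeedCell

end Summit.BirchSwinnertonDyer.BirchSwinnertonDyer.Theorems.AlignedTransportAtTwoFineRoad.InfResSharp

end
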